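/-
K-task «TOWER», part (iv) RIDER B₀ (cell rh-split, lead RULING #401; shape = rh-splitx-theory-1 g12 «FOLD MODULO ℓ^∞»
00:33:10Z (3), accepted by rh-split-ref-2 g7 rider 00:41:19Z with the extra hypothesis `P Config.empty`).  The
SEMANTIC companion of the class form `ClassC`: lattice criteria invariant under bounded perturbations of the fold
are tower-blind.  B26 semantic companion — bookkeeping, 0 width.  Nothing here bears on the truth of RH.
-/
import Summits.RiemannHypothesis.RiemannHypothesis.Theorems.Splittings.ScrewLatticeTowerClassC
import HarnessLib

/-!
# The TOWER barrier, semantic companion B₀: criteria reading the lattice fold modulo `ℓ^∞`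

`ScrewLatticeTowerClassC` (class form A) is the class GENERATED by the thin blind model's clause list.  The finding
recorded with it: a fully SEMANTIC class — predicates determined by the exact fold `k ↦ Ψ_Z(kh)` — is NOT blind
(an on-line fold is a constant minus a positive-coefficient almost periodic cosine series, the tower's fold
converges).  The cut in between (rh-splitx-theory-1 g12, rh-split-ref-2 g7 rider): predicates that read the fold
only MODULO BOUNDED SEQUENCES.  `ClassB₀ h P`: `P Z ↔ P Z'` whenever the folds of `Z` and `Z'` at step `h` differ
by a bounded sequence.  THEOREM `not_criterion_of_classB₀`: if such a `P` holds for the EMPTY configuration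
(`Config.empty`, the RH-shape reference: no off-line zeros, fold `≡ 0`) then `P` holds for the thin polygon tower
(whose fold lies in `[2A, 6A]` on `k ≥ 1` and is `0` at `k = 0`, a bounded perturbation of `0`), which is
non-empty with unattained supremum abscissa — so no class-B₀ criterion forces emptiness.  ζ-free, RH-free; std
axioms.  Nothing here bears on the truth of RH.
-/

noncomputable section

set_option linter.dupNamespace false

open Complex Set
open scoped ComplexConjugate Real

namespace Summit.RiemannHypothesis.RiemannHypothesis.Theorems.Splittings.ScrewLatticeTower

open Summit.RiemannHypothesis.RiemannHypothesis.Theorems.Splittings.ScrewLatticeWolff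

/-- The EMPTY configuration: no off-line zero quadruples (the RH-shape reference configuration). -/
def Config.empty : Config := ⟨PEmpty, fun i ↦ i.elim, fun i ↦ i.elim, fun i ↦ i.elim, fun i ↦ i.elim⟩

/-- The empty configuration has no indices. -/
theorem Config.isEmpty_empty : IsEmpty Config.empty.ι := by
  change IsEmpty PEmpty; infer_instance

/-- The fold of the empty configuration vanishes identically (empty sum). -/
theorem Config.fold_empty (h : ℝ) (k : ℕ) : Config.empty.fold h k = 0 := by
  haveI : IsEmpty Config.empty.ι := Config.isEmpty_empty
  simp only [Config.fold, modelPsi, tsum_empty]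

/-- **Class B₀ («fold modulo `ℓ^∞`»).**  A lattice criterion `P` at step `h` is of class B₀ if it cannot
distinguish two configurations whose lattice folds `k ↦ Ψ_Z(kh)` differ by a BOUNDED sequence.  (Exact-value or
almost-periodicity functionals of the fold are not of class B₀ — they are RH-costumes, see the finding in
`ScrewLatticeTowerClassC`; one-sided growth functionals «`Ψ_Z(kh) ≥ -K e^{ηkh}` for all `η > 0`», «the fold is
bounded below / above / `o(e^{εk})`» are.) -/
def ClassB₀ (h : ℝ) (P : Config → Prop) : Prop :=
  ∀ Z Z' : Config, (∃ K : ℝ, ∀ k : ℕ, |Z.fold h k - Z'.fold h k| ≤ K) → (P Z ↔ P Z')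

/-- The fold of a configuration satisfying the thin blind clauses is a bounded perturbation of the empty fold:
`|Ψ_Z(kh) - 0| ≤ 6A` (`k = 0`: both folds vanish; `k ≥ 1`: `2A ≤ Ψ_Z(kh) ≤ 6A`). -/
theorem exists_abs_fold_sub_empty_le {h σs e : ℝ} {Z : Config} (hZ : ThinBlindClauses h σs e Z) :
    ∃ K : ℝ, ∀ k : ℕ, |Z.fold h k - Config.empty.fold h k| ≤ K := by
  obtain ⟨A, hA, hfl⟩ := hZ.2.2.2.2.2.2.2.1
  refine ⟨6 * A, fun k ↦ ?_⟩
  rw [Config.fold_empty, sub_zero]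
  rcases Nat.eq_zero_or_pos k with rfl | hk
  · have : Z.fold h 0 = 0 := by simp only [Config.fold, Nat.cast_zero, zero_mul, modelPsi_zero]
    rw [this, abs_zero]; positivity
  · obtain ⟨h1, h2⟩ := hfl k hk
    rw [abs_le]; constructor <;> linarith

/-- **The TOWER barrier, semantic form.**  Every class-B₀ criterion at a step `h > 0` that holds for the EMPTY
(RH-shape) configuration also holds for a NON-EMPTY off-line configuration with positive abscissae and unattained
supremum abscissa: the thin polygon tower (its fold is a bounded perturbation of `0`). -/
theorem classB₀_blind_to_tower {h : ℝ} (hh : 0 < h) {P : Config → Prop} (hP : ClassB₀ h P)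
    (h0 : P Config.empty) :
    ∃ Z : Config, P Z ∧ Nonempty Z.ι ∧ (∀ i, 0 < (Z.κ₁ i).re) ∧ (∀ i, ∃ j, (Z.κ₁ i).re < (Z.κ₁ j).re) := by
  obtain ⟨Z, hZ⟩ := exists_thinBlindClauses (σs := 1) (e := 1) hh one_pos one_pos
  exact ⟨Z, (hP Z Config.empty (exists_abs_fold_sub_empty_le hZ)).mpr h0, hZ.1, fun i ↦ (hZ.2.2.1 i).1,
    hZ.2.2.2.2.2.2.1⟩

/-- **No class-B₀ criterion implies RH-emptiness.**  If `P` reads the lattice fold modulo bounded sequences and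
holds for the empty configuration, then `P` does not force the off-line configuration to be empty (nor to have an
attained supremum abscissa). -/
theorem not_criterion_of_classB₀ {h : ℝ} (hh : 0 < h) {P : Config → Prop} (hP : ClassB₀ h P)
    (h0 : P Config.empty) :
    ¬ (∀ Z : Config, P Z → IsEmpty Z.ι) ∧
    ¬ (∀ Z : Config, P Z → ∃ i, ∀ j, (Z.κ₁ j).re ≤ (Z.κ₁ i).re) := by
  obtain ⟨Z, hPZ, hne, -, hsup⟩ := classB₀_blind_to_tower hh hP h0
  refine ⟨fun H ↦ (H Z hPZ).false hne.some, fun H ↦ ?_⟩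
  obtain ⟨i, hi⟩ := H Z hPZ
  obtain ⟨j, hj⟩ := hsup i
  exact absurd (hi j) (not_le.mpr hj)

end Summit.RiemannHypothesis.RiemannHypothesis.Theorems.Splittings.ScrewLatticeTower

end
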